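import Literature.Probability.Moments.BrascampLiebVariance
import Literature.Analysis.Convexity.PrekopaLeindler
import Mathlib.MeasureTheory.Measure.Tilted
import Mathlib.Analysis.Calculus.MeanValue
import Mathlib.Analysis.Calculus.BumpFunction.InnerProduct
import Mathlib.Analysis.Calculus.BumpFunction.FiniteDimension
import Mathlib.Analysis.Complex.Exponential
import Mathlib.MeasureTheory.Integral.DominatedConvergence
import HarnessLib

/-!
# The Brascamp–Lieb variance inequality, uniformly convex case — proof

Topic `Literature/Probability/Moments`. This file DISCHARGES the named fact
`Literature.Probability.Moments.BrascampLieb1976_thm41_uniform` (vendored in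
`BrascampLiebVariance.lean`; Brascamp–Lieb 1976, J. Funct. Anal. 22, Thm 4.1 in the uniformly
convex case `V'' ≥ λ`): `theorem BrascampLieb1976_thm41_uniform_holds`. Fully proved, no new facts.

## The argument (Prékopa–Leindler + linearisation)

Brascamp–Lieb prove Thm 4.1 by induction on the dimension. We take the other classical road,
Prékopa–Leindler ⟹ Brascamp–Lieb by linearisation (Bobkov–Ledoux 2000, GAFA 10, 1028–1052), in a
first-order variant that needs only `f ∈ C¹` and the first-order `λ`-convexity inequality
`V y ≥ V x + ⟨∇V x, y − x⟩ + (λ/2)‖y − x‖²` exactly as it appears in the vendored statement: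

1. `midpoint_le_of_uniformlyConvex`: `V(½x+½y) + (λ/8)‖x−y‖² ≤ (V x + V y)/2`.
2. `hopfLax_le`: for `φ ∈ C¹_c` and `δ > 0`, for small `a > 0`,
   `sup_y [φ y − ‖y−z‖²/(2a)] ≤ φ z + (a/2)(‖Dφ z‖ + δ)²` (uniform continuity of `Dφ` + mean value
   inequality near `z`, boundedness of `φ` far from `z`).
3. `integral_exp_tilted_le_sq`: Prékopa–Leindler (`Literature.Analysis.Convexity.prekopaLeindler`,
   BL76 Thm 3.3) with `s = ½` applied to `e^{-V}`, `e^{-V+εφ}`, `e^{-V+(ε/2)φ + ε²w}`,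
   `w = (‖Dφ‖+δ)²/(8λ)` (admissible by 1–2 with `a = ε/(2λ)`) gives, for `ν = e^{-V}dx/Z`
   (`volume.tilted (-V)`), `∫ e^{εφ} dν ≤ (∫ e^{εφ/2 + ε²w} dν)²` for all small `ε > 0`.
4. `variance_le_of_exp_moment_le` (abstract probability): such an inequality for all small `ε`
   forces `Var_ν(φ) ≤ 8∫ w dν` (second-order expansion in `ε` with explicit remainders:
   `X = e^{εφ/2}`, `Y = e^{ε²w}`, `∫X² − (∫X)² ≤ ∫X(Y−1)·∫X(Y+1) = 2ε²∫w + O(ε³)` and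
   `∫X² − (∫X)² = Var(X−1) = (ε²/4)Var φ + O(ε³)`); with `δ → 0` this is
   `variance_tilted_le_of_hasCompactSupport`: `Var_ν(φ) ≤ λ⁻¹∫‖Dφ‖² dν` for `φ ∈ C¹_c`.
5. `variance_tilted_le`: general `C¹` `f` with `f, f², ‖Df‖² ∈ L¹(ν)` by the truncations
   `f_R = χ(·/R) f` (a `ContDiffBump`) and dominated convergence; `_holds` rewrites this in the
   weighted-Lebesgue form of the fact (`‖∇f‖ = ‖Df‖`, `∫(f−m)²e^{-V} = ∫f²e^{-V} − (∫fe^{-V})²/Z`).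

Not here: the matrix form `Var ≤ ⟨Df, (V'')⁻¹ Df⟩` of BL76 Thm 4.1 (the induction proof), the
log-Sobolev inequality, equality cases.
-/

noncomputable section

open MeasureTheory Set Filter Topology
open scoped RealInnerProductSpace ENNReal NNReal

namespace Literature.Probability.Moments

/-! ### Second-order extraction from an exponential-moment inequality -/

section Extraction

variable {α : Type*} [MeasurableSpace α] {ν : Measure α}

/-- Bounded a.e.-strongly measurable functions are integrable for a finite measure. [folklore] -/
private theorem integrable_of_abs_le [IsFiniteMeasure ν] {u : α → ℝ} (hu : AEStronglyMeasurable u ν)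
    (C : ℝ) (h : ∀ x, |u x| ≤ C) : Integrable u ν :=
  (integrable_const C).mono' hu (Eventually.of_forall fun x => by simpa [Real.norm_eq_abs] using h x)

/-- `exp t ≤ 1 + 2t` for `0 ≤ t ≤ 1`. [folklore] -/
private theorem exp_le_one_add_two_mul {t : ℝ} (h0 : 0 ≤ t) (h1 : t ≤ 1) :
    Real.exp t ≤ 1 + 2 * t := by
  have h := Real.abs_exp_sub_one_sub_id_le (x := t) (by rw [abs_of_nonneg h0]; exact h1)
  have h' := (abs_le.1 h).2
  nlinarith

/-- Algebra: `B ≤ C²`, `0 ≤ C - A ≤ P`, `0 ≤ C + A ≤ Q` give `B - A² ≤ P Q`. [folklore] -/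
private theorem sub_sq_le_of_le_sq {A B C P Q : ℝ} (hBC : B ≤ C ^ 2) (h1 : C - A ≤ P)
    (h2 : C + A ≤ Q) (h1' : 0 ≤ C - A) (h2' : 0 ≤ C + A) : B - A ^ 2 ≤ P * Q := by
  have h : (C - A) * (C + A) ≤ P * Q := mul_le_mul h1 h2 h2' (h1'.trans h1)
  nlinarith [h]

/-- Algebra: `(1 + εM)²(1 + ε²W)² ≤ 1 + ε(a + b + ab)` with `a = 2M + M²`, `b = 2W + W²`,
for `0 < ε ≤ 1`. [folklore] -/
private theorem coeff_bound {ε M W : ℝ} (hε : 0 < ε) (hε1 : ε ≤ 1) (hM : 0 ≤ M) (hW : 0 ≤ W) :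
    (1 + ε * M) ^ 2 * (1 + ε ^ 2 * W) ^ 2 ≤
      1 + ε * ((2 * M + M ^ 2) + (2 * W + W ^ 2) + (2 * M + M ^ 2) * (2 * W + W ^ 2)) := by
  have hε2 : ε ^ 2 ≤ ε := by nlinarith
  have hε4 : ε ^ 4 ≤ ε := (pow_le_pow_of_le_one hε.le hε1 (by norm_num : 2 ≤ 4)).trans hε2
  have ha : (1 + ε * M) ^ 2 ≤ 1 + ε * (2 * M + M ^ 2) := by
    nlinarith [mul_le_mul_of_nonneg_right hε2 (sq_nonneg M)]
  have hb : (1 + ε ^ 2 * W) ^ 2 ≤ 1 + ε * (2 * W + W ^ 2) := by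
    nlinarith [mul_le_mul_of_nonneg_right hε2 hW, mul_le_mul_of_nonneg_right hε4 (sq_nonneg W)]
  have hab : (1 + ε * (2 * M + M ^ 2)) * (1 + ε * (2 * W + W ^ 2)) ≤
      1 + ε * ((2 * M + M ^ 2) + (2 * W + W ^ 2) + (2 * M + M ^ 2) * (2 * W + W ^ 2)) := by
    have : ε ^ 2 * ((2 * M + M ^ 2) * (2 * W + W ^ 2)) ≤ ε * ((2 * M + M ^ 2) * (2 * W + W ^ 2)) :=
      mul_le_mul_of_nonneg_right hε2 (mul_nonneg (by positivity) (by positivity))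
    nlinarith [this]
  exact le_trans (mul_le_mul ha hb (by positivity) (by positivity)) hab

/-- Algebra: if `X - 1 = εφ/2 + R` with `|φ| ≤ M`, `|R| ≤ ε²M²/4`, then
`ε²φ²/4 − ε³M³/4 ≤ (X − 1)²`. [folklore] -/
private theorem lower_pointwise {X φ R ε M : ℝ} (hε : 0 < ε) (hM : 0 ≤ M) (hR : X - 1 = ε / 2 * φ + R)
    (hφ : |φ| ≤ M) (hRb : |R| ≤ ε ^ 2 * M ^ 2 / 4) :
    ε ^ 2 / 4 * φ ^ 2 - ε ^ 3 * M ^ 3 / 4 ≤ (X - 1) ^ 2 := by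
  have hprod : |ε * φ * R| ≤ ε ^ 3 * M ^ 3 / 4 := by
    rw [abs_mul, abs_mul, abs_of_pos hε]
    calc ε * |φ| * |R| ≤ ε * M * (ε ^ 2 * M ^ 2 / 4) :=
          mul_le_mul (mul_le_mul_of_nonneg_left hφ hε.le) hRb (abs_nonneg _) (by positivity)
      _ = ε ^ 3 * M ^ 3 / 4 := by ring
  have h1 := (abs_le.1 hprod).1
  rw [hR]
  nlinarith [sq_nonneg R]

/-- Algebra: `|u| ≤ εM/2`, `|v| ≤ ε²M²/4`, `0 < ε ≤ 1` give `(u+v)² ≤ u² + ε³(M³/4 + M⁴/16)`.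
[folklore] -/
private theorem sq_add_le_of_abs_le {u v ε M : ℝ} (hε : 0 < ε) (hε1 : ε ≤ 1) (hM : 0 ≤ M)
    (hu : |u| ≤ ε * M / 2) (hv : |v| ≤ ε ^ 2 * M ^ 2 / 4) :
    (u + v) ^ 2 ≤ u ^ 2 + ε ^ 3 * (M ^ 3 / 4 + M ^ 4 / 16) := by
  have huv : |u| * |v| ≤ (ε * M / 2) * (ε ^ 2 * M ^ 2 / 4) :=
    mul_le_mul hu hv (abs_nonneg _) (by positivity)
  have hv2 : v ^ 2 ≤ (ε ^ 2 * M ^ 2 / 4) ^ 2 := by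
    calc v ^ 2 = |v| ^ 2 := (sq_abs _).symm
      _ ≤ (ε ^ 2 * M ^ 2 / 4) ^ 2 := pow_le_pow_left₀ (abs_nonneg _) hv 2
  have huv' : u * v ≤ |u| * |v| := by rw [← abs_mul]; exact le_abs_self _
  have hε4 : ε ^ 4 ≤ ε ^ 3 := pow_le_pow_of_le_one hε.le hε1 (by norm_num)
  have hM4 : ε ^ 4 * M ^ 4 ≤ ε ^ 3 * M ^ 4 := mul_le_mul_of_nonneg_right hε4 (by positivity)
  nlinarith [huv, hv2, huv', hM4]

variable (ν) in
/-- The estimate at a fixed small `ε`: under the hypotheses of `variance_le_of_exp_moment_le`,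
`Var_ν(φ) ≤ 8∫w + ε·K` with an explicit `K = K(M, W)`. [folklore] -/
private theorem variance_le_of_exp_moment_le_aux [IsProbabilityMeasure ν] {φ w : α → ℝ}
    (hφm : AEStronglyMeasurable φ ν) (hwm : AEStronglyMeasurable w ν) {M W ε : ℝ}
    (hM : 0 ≤ M) (hW : 0 ≤ W) (hφb : ∀ x, |φ x| ≤ M) (hw0 : ∀ x, 0 ≤ w x) (hwb : ∀ x, w x ≤ W)
    (hε : 0 < ε) (hε1 : ε ≤ 1) (hεM : ε * M ≤ 1) (hεW : ε ^ 2 * W ≤ 1)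
    (H : ∫ x, Real.exp (ε * φ x) ∂ν ≤ (∫ x, Real.exp (ε / 2 * φ x + ε ^ 2 * w x) ∂ν) ^ 2) :
    ∫ x, φ x ^ 2 ∂ν - (∫ x, φ x ∂ν) ^ 2 ≤
      8 * ∫ x, w x ∂ν + ε * (8 * ((2 * M + M ^ 2) + (2 * W + W ^ 2) +
        (2 * M + M ^ 2) * (2 * W + W ^ 2)) * W + 4 * (M ^ 3 / 4 + (M ^ 3 / 4 + M ^ 4 / 16))) := by
  set K₁ : ℝ := (2 * M + M ^ 2) + (2 * W + W ^ 2) + (2 * M + M ^ 2) * (2 * W + W ^ 2) with hK₁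
  set K₂ : ℝ := M ^ 3 / 4 + (M ^ 3 / 4 + M ^ 4 / 16) with hK₂
  have hK₁0 : 0 ≤ K₁ := by positivity
  -- basic integrability
  have hIφ : Integrable φ ν := integrable_of_abs_le hφm M hφb
  have hφ2b : ∀ x, φ x ^ 2 ≤ M ^ 2 := fun x => by
    calc φ x ^ 2 = |φ x| ^ 2 := (sq_abs _).symm
      _ ≤ M ^ 2 := pow_le_pow_left₀ (abs_nonneg _) (hφb x) 2
  have hIφ2 : Integrable (fun x => φ x ^ 2) ν :=
    integrable_of_abs_le (hφm.pow 2) (M ^ 2) fun x => by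
      rw [abs_of_nonneg (sq_nonneg _)]; exact hφ2b x
  have hIw : Integrable w ν := integrable_of_abs_le hwm W fun x => by
    rw [abs_of_nonneg (hw0 x)]; exact hwb x
  have hw_int_le : ∫ x, w x ∂ν ≤ W := by
    calc ∫ x, w x ∂ν ≤ ∫ _, W ∂ν := integral_mono hIw (integrable_const W) hwb
      _ = W := by simp
  have hw_int_nn : 0 ≤ ∫ x, w x ∂ν := integral_nonneg hw0
  have hφ_int_abs : |∫ x, φ x ∂ν| ≤ M := by
    calc |∫ x, φ x ∂ν| ≤ ∫ x, |φ x| ∂ν := abs_integral_le_integral_abs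
      _ ≤ ∫ _, M ∂ν := integral_mono hIφ.abs (integrable_const M) hφb
      _ = M := by simp
  set Iw := ∫ x, w x ∂ν with hIw_def
  -- the players
  set X : α → ℝ := fun x => Real.exp (ε / 2 * φ x) with hX
  set Y : α → ℝ := fun x => Real.exp (ε ^ 2 * w x) with hY
  set R : α → ℝ := fun x => X x - 1 - ε / 2 * φ x with hR
  have hXm : AEStronglyMeasurable X ν :=
    Real.continuous_exp.comp_aestronglyMeasurable (hφm.const_mul _)
  have hYm : AEStronglyMeasurable Y ν :=
    Real.continuous_exp.comp_aestronglyMeasurable (hwm.const_mul _)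
  have hXpos : ∀ x, 0 < X x := fun x => Real.exp_pos _
  have hε2pos : (0:ℝ) < ε / 2 := by linarith
  have harg : ∀ x, |ε / 2 * φ x| ≤ 1 := fun x => by
    rw [abs_mul, abs_of_pos hε2pos]
    calc ε / 2 * |φ x| ≤ ε / 2 * M := mul_le_mul_of_nonneg_left (hφb x) hε2pos.le
      _ ≤ 1 := by linarith
  have hXle : ∀ x, X x ≤ 1 + ε * M := fun x => by
    have h1 : X x ≤ Real.exp (ε / 2 * M) := Real.exp_le_exp.2 (by
      calc ε / 2 * φ x ≤ ε / 2 * |φ x| := mul_le_mul_of_nonneg_left (le_abs_self _) hε2pos.le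
        _ ≤ ε / 2 * M := mul_le_mul_of_nonneg_left (hφb x) hε2pos.le)
    have h2 : Real.exp (ε / 2 * M) ≤ 1 + 2 * (ε / 2 * M) :=
      exp_le_one_add_two_mul (by positivity) (by linarith)
    linarith
  have hXabs : ∀ x, |X x| ≤ 2 := fun x => by
    rw [abs_of_pos (hXpos x)]; linarith [hXle x]
  have hw2 : ∀ x, ε ^ 2 * w x ≤ 1 := fun x =>
    le_trans (mul_le_mul_of_nonneg_left (hwb x) (sq_nonneg _)) hεW
  have hY1 : ∀ x, 1 ≤ Y x := fun x => Real.one_le_exp (mul_nonneg (sq_nonneg _) (hw0 x))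
  have hYle : ∀ x, Y x ≤ 1 + 2 * (ε ^ 2 * w x) := fun x =>
    exp_le_one_add_two_mul (mul_nonneg (sq_nonneg _) (hw0 x)) (hw2 x)
  have hYle' : ∀ x, Y x - 1 ≤ ε ^ 2 * w x * (1 + ε ^ 2 * W) := fun x => by
    have h0 : 0 ≤ ε ^ 2 * w x := mul_nonneg (sq_nonneg _) (hw0 x)
    have h := (abs_le.1 (Real.abs_exp_sub_one_sub_id_le (x := ε ^ 2 * w x)
      (by rw [abs_of_nonneg h0]; exact hw2 x))).2
    have h' : (ε ^ 2 * w x) ^ 2 ≤ ε ^ 2 * w x * (ε ^ 2 * W) := by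
      rw [sq]; exact mul_le_mul_of_nonneg_left (mul_le_mul_of_nonneg_left (hwb x) (sq_nonneg _)) h0
    change Real.exp (ε ^ 2 * w x) - 1 ≤ _
    nlinarith [h, h']
  have hYabs : ∀ x, |Y x| ≤ 3 := fun x => by
    rw [abs_of_pos (Real.exp_pos _)]; linarith [hYle x, hw2 x]
  have hRabs : ∀ x, |R x| ≤ ε ^ 2 * M ^ 2 / 4 := fun x => by
    calc |R x| = |Real.exp (ε / 2 * φ x) - 1 - ε / 2 * φ x| := rfl
      _ ≤ (ε / 2 * φ x) ^ 2 := Real.abs_exp_sub_one_sub_id_le (harg x)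
      _ = ε ^ 2 / 4 * φ x ^ 2 := by ring
      _ ≤ ε ^ 2 / 4 * M ^ 2 := mul_le_mul_of_nonneg_left (hφ2b x) (by positivity)
      _ = ε ^ 2 * M ^ 2 / 4 := by ring
  -- integrability of the players
  have hIX : Integrable X ν := integrable_of_abs_le hXm 2 hXabs
  have hIX2 : Integrable (fun x => X x ^ 2) ν :=
    integrable_of_abs_le (hXm.pow 2) 4 fun x => by
      rw [abs_pow]; nlinarith [hXabs x, abs_nonneg (X x)]
  have hIXY : Integrable (fun x => X x * Y x) ν :=
    integrable_of_abs_le (hXm.mul hYm) 6 fun x => by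
      rw [abs_mul]; nlinarith [hXabs x, hYabs x, abs_nonneg (X x), abs_nonneg (Y x)]
  have hIR : Integrable R ν := (hIX.sub (integrable_const 1)).sub (hIφ.const_mul _)
  have hID2 : Integrable (fun x => (X x - 1) ^ 2) ν := by
    have h := (hIX2.sub (hIX.const_mul 2)).add (integrable_const (1:ℝ))
    refine h.congr (Eventually.of_forall fun x => ?_)
    simp only [Pi.add_apply, Pi.sub_apply]
    ring
  -- names for the integrals
  set A := ∫ x, X x ∂ν with hA
  set B := ∫ x, X x ^ 2 ∂ν with hB
  set C := ∫ x, X x * Y x ∂ν with hC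
  have hA_nn : 0 ≤ A := integral_nonneg fun x => (hXpos x).le
  -- the hypothesis in terms of `B` and `C`
  have hBC : B ≤ C ^ 2 := by
    have e1 : ∫ x, Real.exp (ε * φ x) ∂ν = B := by
      rw [hB]; congr 1; ext x; rw [hX]; dsimp only
      rw [sq, ← Real.exp_add]; congr 1; ring
    have e2 : ∫ x, Real.exp (ε / 2 * φ x + ε ^ 2 * w x) ∂ν = C := by
      rw [hC]; congr 1; ext x; rw [hX, hY]; dsimp only
      rw [← Real.exp_add]
    rwa [e1, e2] at H
  -- upper bound: `C - A = ∫ X (Y - 1) ≤ (1 + εM) 2ε² ∫ w`, `C + A ≤ (1 + εM)(2 + 2ε²W)`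
  have hCA1 : C - A = ∫ x, X x * (Y x - 1) ∂ν := by
    rw [hC, hA, ← integral_sub hIXY hIX]; congr 1; ext x; ring
  have hCA2 : C + A = ∫ x, X x * (Y x + 1) ∂ν := by
    rw [hC, hA, ← integral_add hIXY hIX]; congr 1; ext x; ring
  have hI1 : Integrable (fun x => X x * (Y x - 1)) ν :=
    (hIXY.sub hIX).congr (Eventually.of_forall fun x => by simp only [Pi.sub_apply]; ring)
  have hI2 : Integrable (fun x => X x * (Y x + 1)) ν :=
    (hIXY.add hIX).congr (Eventually.of_forall fun x => by simp only [Pi.add_apply]; ring)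
  have hup1 : C - A ≤ (1 + ε * M) * (1 + ε ^ 2 * W) * ε ^ 2 * Iw := by
    rw [hCA1, hIw_def, ← integral_const_mul]
    refine integral_mono hI1 (hIw.const_mul _) fun x => ?_
    have h2 : 0 ≤ Y x - 1 := by linarith [hY1 x]
    calc X x * (Y x - 1) ≤ (1 + ε * M) * (ε ^ 2 * w x * (1 + ε ^ 2 * W)) :=
          mul_le_mul (hXle x) (hYle' x) h2 (by positivity)
      _ = (1 + ε * M) * (1 + ε ^ 2 * W) * ε ^ 2 * w x := by ring
  have hup2 : C + A ≤ (1 + ε * M) * (2 + 2 * ε ^ 2 * W) := by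
    rw [hCA2]
    calc ∫ x, X x * (Y x + 1) ∂ν ≤ ∫ _, (1 + ε * M) * (2 + 2 * ε ^ 2 * W) ∂ν := by
          refine integral_mono hI2 (integrable_const _) fun x => ?_
          have h1 : Y x + 1 ≤ 2 + 2 * ε ^ 2 * W := by
            have h2 : ε ^ 2 * w x ≤ ε ^ 2 * W := mul_le_mul_of_nonneg_left (hwb x) (sq_nonneg _)
            linarith [hYle x]
          exact mul_le_mul (hXle x) h1 (by linarith [hY1 x]) (by positivity)
      _ = (1 + ε * M) * (2 + 2 * ε ^ 2 * W) := by simp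
  have hCA_nn : 0 ≤ C - A := by
    rw [hCA1]; exact integral_nonneg fun x => mul_nonneg (hXpos x).le (by linarith [hY1 x])
  have hCA_nn' : 0 ≤ C + A := by linarith
  have hupper : B - A ^ 2 ≤ 2 * ε ^ 2 * (1 + ε * K₁) * Iw := by
    have h12 := sub_sq_le_of_le_sq hBC hup1 hup2 hCA_nn hCA_nn'
    have h3 : (1 + ε * M) ^ 2 * (1 + ε ^ 2 * W) ^ 2 ≤ 1 + ε * K₁ := coeff_bound hε hε1 hM hW
    have e1 : ((1 + ε * M) * (1 + ε ^ 2 * W) * ε ^ 2 * Iw) * ((1 + ε * M) * (2 + 2 * ε ^ 2 * W)) =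
        (2 * ε ^ 2 * Iw) * ((1 + ε * M) ^ 2 * (1 + ε ^ 2 * W) ^ 2) := by ring
    have h4 : (2 * ε ^ 2 * Iw) * ((1 + ε * M) ^ 2 * (1 + ε ^ 2 * W) ^ 2) ≤
        (2 * ε ^ 2 * Iw) * (1 + ε * K₁) := mul_le_mul_of_nonneg_left h3 (by positivity)
    have e2 : (2 * ε ^ 2 * Iw) * (1 + ε * K₁) = 2 * ε ^ 2 * (1 + ε * K₁) * Iw := by ring
    linarith
  -- lower bound: `B - A² = ∫ (X-1)² - (∫ (X-1))²`, `X - 1 = εφ/2 + R`, `|R| ≤ ε²M²/4`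
  have hD1 : B - A ^ 2 = ∫ x, (X x - 1) ^ 2 ∂ν - (∫ x, (X x - 1) ∂ν) ^ 2 := by
    have e1 : ∫ x, (X x - 1) ^ 2 ∂ν = B - 2 * A + 1 := by
      have : (fun x => (X x - 1) ^ 2) = fun x => X x ^ 2 - 2 * X x + 1 := by ext x; ring
      have hI : Integrable (fun x => X x ^ 2 - 2 * X x) ν := hIX2.sub (hIX.const_mul 2)
      rw [this, integral_add hI (integrable_const 1), integral_sub hIX2 (hIX.const_mul 2),
        integral_const_mul]
      simp [hA, hB]
    have e2 : ∫ x, (X x - 1) ∂ν = A - 1 := by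
      rw [integral_sub hIX (integrable_const 1)]; simp [hA]
    rw [e1, e2]; ring
  have hlow1 : ε ^ 2 / 4 * ∫ x, φ x ^ 2 ∂ν - ε ^ 3 * M ^ 3 / 4 ≤ ∫ x, (X x - 1) ^ 2 ∂ν := by
    have e : ∫ x, (ε ^ 2 / 4 * φ x ^ 2 - ε ^ 3 * M ^ 3 / 4) ∂ν =
        ε ^ 2 / 4 * ∫ x, φ x ^ 2 ∂ν - ε ^ 3 * M ^ 3 / 4 := by
      rw [integral_sub (hIφ2.const_mul _) (integrable_const _), integral_const_mul]; simp
    rw [← e]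
    refine integral_mono ((hIφ2.const_mul _).sub (integrable_const _)) hID2 fun x => ?_
    have hx : X x - 1 = ε / 2 * φ x + R x := by simp only [hR]; ring
    exact lower_pointwise hε hM hx (hφb x) (hRabs x)
  have hlow2 : (∫ x, (X x - 1) ∂ν) ^ 2 ≤
      ε ^ 2 / 4 * (∫ x, φ x ∂ν) ^ 2 + ε ^ 3 * (M ^ 3 / 4 + M ^ 4 / 16) := by
    have e : ∫ x, (X x - 1) ∂ν = ε / 2 * ∫ x, φ x ∂ν + ∫ x, R x ∂ν := by
      rw [← integral_const_mul, ← integral_add (hIφ.const_mul _) hIR]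
      congr 1; ext x; simp only [hR]; ring
    have hv : |∫ x, R x ∂ν| ≤ ε ^ 2 * M ^ 2 / 4 := by
      have h := norm_integral_le_of_norm_le_const (μ := ν) (f := R) (C := ε ^ 2 * M ^ 2 / 4)
        (Eventually.of_forall fun x => by rw [Real.norm_eq_abs]; exact hRabs x)
      simpa [Real.norm_eq_abs] using h
    have hu : |ε / 2 * ∫ x, φ x ∂ν| ≤ ε * M / 2 := by
      rw [abs_mul, abs_of_pos hε2pos]
      calc ε / 2 * |∫ x, φ x ∂ν| ≤ ε / 2 * M := mul_le_mul_of_nonneg_left hφ_int_abs hε2pos.le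
        _ = ε * M / 2 := by ring
    rw [e]
    have key := sq_add_le_of_abs_le hε hε1 hM hu hv
    have hu2 : (ε / 2 * ∫ x, φ x ∂ν) ^ 2 = ε ^ 2 / 4 * (∫ x, φ x ∂ν) ^ 2 := by ring
    linarith
  have hlower : ε ^ 2 / 4 * (∫ x, φ x ^ 2 ∂ν - (∫ x, φ x ∂ν) ^ 2) - ε ^ 3 * K₂ ≤ B - A ^ 2 := by
    rw [hD1, hK₂]; linarith [hlow1, hlow2]
  -- combine
  have hcomb : ε ^ 2 * ((∫ x, φ x ^ 2 ∂ν - (∫ x, φ x ∂ν) ^ 2) / 4 - ε * K₂) ≤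
      ε ^ 2 * (2 * (1 + ε * K₁) * Iw) := by
    have h := hlower.trans hupper
    have e1 : ε ^ 2 * ((∫ x, φ x ^ 2 ∂ν - (∫ x, φ x ∂ν) ^ 2) / 4 - ε * K₂) =
        ε ^ 2 / 4 * (∫ x, φ x ^ 2 ∂ν - (∫ x, φ x ∂ν) ^ 2) - ε ^ 3 * K₂ := by ring
    have e2 : ε ^ 2 * (2 * (1 + ε * K₁) * Iw) = 2 * ε ^ 2 * (1 + ε * K₁) * Iw := by ring
    rw [e1, e2]; exact h
  have hdiv := le_of_mul_le_mul_left hcomb (by positivity)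
  have hKw : ε * K₁ * Iw ≤ ε * K₁ * W := mul_le_mul_of_nonneg_left hw_int_le (by positivity)
  have e3 : 2 * (1 + ε * K₁) * Iw = 2 * Iw + 2 * (ε * K₁ * Iw) := by ring
  rw [e3] at hdiv
  linarith

/-- **Second-order extraction.** For a probability measure `ν`, bounded `φ` (`|φ| ≤ M`) and
`0 ≤ w ≤ W`: if `∫ e^{εφ} dν ≤ (∫ e^{εφ/2 + ε² w} dν)²` for all small `ε > 0`, then
`Var_ν(φ) = ∫ φ² dν − (∫ φ dν)² ≤ 8 ∫ w dν`. (Expand to second order in `ε`: with `X = e^{εφ/2}`,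
`Y = e^{ε² w}`, `∫X² − (∫X)² ≤ (∫XY)² − (∫X)² = ∫X(Y−1) · ∫X(Y+1) = 2ε²∫w + O(ε³)` while
`∫X² − (∫X)² = Var(X − 1) = (ε²/4) Var φ + O(ε³)`.) [folklore] -/
theorem variance_le_of_exp_moment_le (ν : Measure α) [IsProbabilityMeasure ν] {φ w : α → ℝ}
    (hφm : AEStronglyMeasurable φ ν) (hwm : AEStronglyMeasurable w ν) {M W ε₀ : ℝ}
    (hM : 0 ≤ M) (hW : 0 ≤ W) (hε₀ : 0 < ε₀) (hφb : ∀ x, |φ x| ≤ M) (hw0 : ∀ x, 0 ≤ w x)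
    (hwb : ∀ x, w x ≤ W)
    (H : ∀ ε, 0 < ε → ε ≤ ε₀ →
      ∫ x, Real.exp (ε * φ x) ∂ν ≤ (∫ x, Real.exp (ε / 2 * φ x + ε ^ 2 * w x) ∂ν) ^ 2) :
    ∫ x, φ x ^ 2 ∂ν - (∫ x, φ x ∂ν) ^ 2 ≤ 8 * ∫ x, w x ∂ν := by
  set K₃ : ℝ := 8 * ((2 * M + M ^ 2) + (2 * W + W ^ 2) + (2 * M + M ^ 2) * (2 * W + W ^ 2)) * W +
    4 * (M ^ 3 / 4 + (M ^ 3 / 4 + M ^ 4 / 16)) with hK₃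
  have hK₃0 : 0 ≤ K₃ := by positivity
  set ε₁ : ℝ := min ε₀ (min (1 / (M + 1)) (1 / (W + 1))) with hε₁
  have hε₁0 : 0 < ε₁ := by positivity
  have main : ∀ ε, 0 < ε → ε ≤ ε₁ →
      ∫ x, φ x ^ 2 ∂ν - (∫ x, φ x ∂ν) ^ 2 ≤ 8 * ∫ x, w x ∂ν + ε * K₃ := by
    intro ε hε hεle
    have hε0 : ε ≤ ε₀ := hεle.trans (min_le_left _ _)
    have hεM' : ε ≤ 1 / (M + 1) := hεle.trans ((min_le_right _ _).trans (min_le_left _ _))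
    have hεW' : ε ≤ 1 / (W + 1) := hεle.trans ((min_le_right _ _).trans (min_le_right _ _))
    rw [le_div_iff₀ (by positivity)] at hεM' hεW'
    have hε1 : ε ≤ 1 := by nlinarith
    have hεM : ε * M ≤ 1 := by nlinarith
    have hεW : ε ^ 2 * W ≤ 1 := by nlinarith
    exact variance_le_of_exp_moment_le_aux ν hφm hwm hM hW hφb hw0 hwb hε hε1 hεM hεW (H ε hε hε0)
  -- let ε → 0
  refine le_of_forall_pos_le_add fun η hη => ?_
  set ε := min ε₁ (η / (K₃ + 1)) with hε_def
  have hεpos : 0 < ε := by positivity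
  have h1 := main ε hεpos (min_le_left _ _)
  have h2 : ε * K₃ ≤ η := by
    have hle : ε ≤ η / (K₃ + 1) := min_le_right _ _
    rw [le_div_iff₀ (by positivity)] at hle
    nlinarith
  linarith

end Extraction

/-! ### Uniform convexity, the Hopf–Lax bound and the exponential-moment inequality -/

section Euclidean

variable {n : ℕ}

/-- Midpoint form of `λ`-uniform convexity: from `V y ≥ V x + ⟨∇V x, y − x⟩ + (λ/2)‖y − x‖²`,
`V(½x + ½y) + (λ/8)‖x − y‖² ≤ (V x + V y)/2`. [folklore] -/
theorem midpoint_le_of_uniformlyConvex {V : EuclideanSpace ℝ (Fin n) → ℝ} {lam : ℝ}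
    (hV : ∀ x y : EuclideanSpace ℝ (Fin n),
      V x + ⟪gradient V x, y - x⟫ + lam / 2 * ‖y - x‖ ^ 2 ≤ V y)
    (x y : EuclideanSpace ℝ (Fin n)) :
    V ((1 / 2 : ℝ) • x + (1 / 2 : ℝ) • y) + lam / 8 * ‖x - y‖ ^ 2 ≤ (V x + V y) / 2 := by
  set z := (1 / 2 : ℝ) • x + (1 / 2 : ℝ) • y with hz
  have h1 := hV z x
  have h2 := hV z y
  have hxz : x - z = (1 / 2 : ℝ) • (x - y) := by rw [hz]; module
  have hyz : y - z = -((1 / 2 : ℝ) • (x - y)) := by rw [hz]; module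
  have hinner : ⟪gradient V z, x - z⟫ + ⟪gradient V z, y - z⟫ = 0 := by
    rw [← inner_add_right, hxz, hyz, add_neg_cancel, inner_zero_right]
  have hhalf : ‖(1 / 2 : ℝ) • (x - y)‖ = 1 / 2 * ‖x - y‖ := by
    rw [norm_smul, Real.norm_eq_abs, abs_of_pos (by norm_num : (0:ℝ) < 1 / 2)]
  have hn1 : ‖x - z‖ ^ 2 = 1 / 4 * ‖x - y‖ ^ 2 := by rw [hxz, hhalf]; ring
  have hn2 : ‖y - z‖ ^ 2 = 1 / 4 * ‖x - y‖ ^ 2 := by rw [hyz, norm_neg, hhalf]; ring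
  rw [hn1] at h1
  rw [hn2] at h2
  linarith

/-- AM–GM step of the Hopf–Lax bound: `c ρ − ρ²/(2a) ≤ (a/2) c²` for `a > 0`. [folklore] -/
private theorem mul_sub_sq_div_le {a c ρ : ℝ} (ha : 0 < a) :
    c * ρ - ρ ^ 2 / (2 * a) ≤ a / 2 * c ^ 2 := by
  have key : a / 2 * c ^ 2 - (c * ρ - ρ ^ 2 / (2 * a)) = (a * c - ρ) ^ 2 / (2 * a) := by
    field_simp
    ring
  have : 0 ≤ (a * c - ρ) ^ 2 / (2 * a) := div_nonneg (sq_nonneg _) (by positivity)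
  linarith

/-- **Hopf–Lax (sup-convolution) bound** for a `C¹` function with compact support: for every
`δ > 0` there is `a₀ > 0` such that for `0 < a ≤ a₀` and all `y, z`,
`φ y − ‖y − z‖²/(2a) ≤ φ z + (a/2)(‖Dφ z‖ + δ)²`, i.e. `Q_a φ ≤ φ + (a/2)(‖Dφ‖ + δ)²` for the
sup-convolution `Q_a φ(z) = sup_y [φ y − ‖y−z‖²/(2a)]` (first-order Taylor bound from the uniform
continuity of `Dφ`, plus boundedness of `φ` for far-away `y`). [folklore] -/
theorem hopfLax_le {φ : EuclideanSpace ℝ (Fin n) → ℝ} (hφ : ContDiff ℝ 1 φ)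
    (hφs : HasCompactSupport φ) {δ : ℝ} (hδ : 0 < δ) :
    ∃ a₀ > 0, ∀ a, 0 < a → a ≤ a₀ → ∀ y z : EuclideanSpace ℝ (Fin n),
      φ y - ‖y - z‖ ^ 2 / (2 * a) ≤ φ z + a / 2 * (‖fderiv ℝ φ z‖ + δ) ^ 2 := by
  obtain ⟨M, hM⟩ := hφ.continuous.bounded_above_of_compact_support hφs
  have hM0 : 0 ≤ M := (norm_nonneg _).trans (hM 0)
  have hdiff : Differentiable ℝ φ := hφ.differentiable one_ne_zero
  have hDc : Continuous (fderiv ℝ φ) := hφ.continuous_fderiv one_ne_zero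
  have hDu : UniformContinuous (fderiv ℝ φ) :=
    (hφs.fderiv (𝕜 := ℝ)).uniformContinuous_of_continuous hDc
  obtain ⟨r, hr, hru⟩ := Metric.uniformContinuous_iff.1 hDu δ hδ
  refine ⟨r ^ 2 / (4 * M + 4), by positivity, fun a ha haa y z => ?_⟩
  by_cases hyz : dist y z < r
  · -- Taylor bound on the ball `B(z, r)`
    have hmvt : ‖φ y - φ z - (fderiv ℝ φ z) (y - z)‖ ≤ δ * ‖y - z‖ := by
      refine (convex_ball z r).norm_image_sub_le_of_norm_fderiv_le' (𝕜 := ℝ)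
        (fun w _ => hdiff w) (fun w hw => ?_) (Metric.mem_ball_self hr) hyz
      rw [← dist_eq_norm]; exact (hru (Metric.mem_ball.1 hw)).le
    have h1 : φ y - φ z - (fderiv ℝ φ z) (y - z) ≤ δ * ‖y - z‖ :=
      (le_abs_self _).trans (by simpa [Real.norm_eq_abs] using hmvt)
    have h2 : (fderiv ℝ φ z) (y - z) ≤ ‖fderiv ℝ φ z‖ * ‖y - z‖ :=
      (le_abs_self _).trans (by simpa [Real.norm_eq_abs] using (fderiv ℝ φ z).le_opNorm (y - z))
    have h3 := mul_sub_sq_div_le (c := ‖fderiv ℝ φ z‖ + δ) (ρ := ‖y - z‖) ha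
    nlinarith [h1, h2, h3]
  · -- far away: `φ y − ‖y−z‖²/(2a) ≤ M − r²/(2a) ≤ −M ≤ φ z`
    have hr' : r ≤ ‖y - z‖ := by rw [← dist_eq_norm]; exact not_lt.1 hyz
    have hy : φ y ≤ M := (le_abs_self _).trans (by simpa [Real.norm_eq_abs] using hM y)
    have hz : -M ≤ φ z := by
      have := hM z
      rw [Real.norm_eq_abs] at this
      linarith [neg_abs_le (φ z)]
    have hsq : r ^ 2 ≤ ‖y - z‖ ^ 2 := pow_le_pow_left₀ hr.le hr' 2
    have hdiv : r ^ 2 / (2 * a) ≤ ‖y - z‖ ^ 2 / (2 * a) :=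
      div_le_div_of_nonneg_right hsq (by positivity)
    have hbig : 2 * M + 2 ≤ r ^ 2 / (2 * a) := by
      rw [le_div_iff₀ (by positivity)]
      have : a * (4 * M + 4) ≤ r ^ 2 := by
        have := (le_div_iff₀ (by positivity : (0:ℝ) < 4 * M + 4)).1 haa
        linarith
      linarith
    have hnn : 0 ≤ a / 2 * (‖fderiv ℝ φ z‖ + δ) ^ 2 := by positivity
    linarith

/-- Prékopa–Leindler at `s = ½` in exponential form: if `(p x + q y)/2 ≤ r(½x + ½y)` then
`(∫ eᵖ)(∫ e^q) ≤ (∫ eʳ)²`. [cite: BrascampLieb1976, Thm 3.3] -/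
theorem integral_exp_mul_integral_exp_le_sq {p q r : EuclideanSpace ℝ (Fin n) → ℝ}
    (hp : Continuous p) (hq : Continuous q) (hr : Continuous r)
    (hpi : Integrable fun x => Real.exp (p x)) (hqi : Integrable fun x => Real.exp (q x))
    (hri : Integrable fun x => Real.exp (r x))
    (H : ∀ x y, (p x + q y) / 2 ≤ r ((1 / 2 : ℝ) • x + (1 / 2 : ℝ) • y)) :
    (∫ x, Real.exp (p x)) * (∫ y, Real.exp (q y)) ≤ (∫ z, Real.exp (r z)) ^ 2 := by
  have key := Literature.Analysis.Convexity.prekopaLeindler_integral (n := n) (s := 1 / 2)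
    (by norm_num) (by norm_num) (hp.measurable.exp) (hq.measurable.exp) (hr.measurable.exp)
    (fun x => (Real.exp_pos _).le) (fun x => (Real.exp_pos _).le) (fun x => (Real.exp_pos _).le)
    hpi hqi hri (fun x y => by
      rw [← Real.exp_mul, ← Real.exp_mul, ← Real.exp_add]
      apply Real.exp_le_exp.2
      have := H x y
      norm_num at this ⊢
      linarith)
  have h0p : 0 ≤ ∫ x, Real.exp (p x) := integral_nonneg fun _ => (Real.exp_pos _).le
  have h0q : 0 ≤ ∫ x, Real.exp (q x) := integral_nonneg fun _ => (Real.exp_pos _).le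
  have h0r : 0 ≤ ∫ x, Real.exp (r x) := integral_nonneg fun _ => (Real.exp_pos _).le
  norm_num at key
  have hsq : ((∫ x, Real.exp (p x)) ^ (1 / 2 : ℝ) * (∫ x, Real.exp (q x)) ^ (1 / 2 : ℝ)) ^ 2 =
      (∫ x, Real.exp (p x)) * (∫ y, Real.exp (q y)) := by
    rw [mul_pow, ← Real.rpow_natCast, ← Real.rpow_natCast, ← Real.rpow_mul h0p,
      ← Real.rpow_mul h0q]
    norm_num
  rw [← hsq]
  exact pow_le_pow_left₀ (by positivity) key 2

/-- **Exponential-moment inequality from Prékopa–Leindler** (the linearisable form of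
Brascamp–Lieb, after Bobkov–Ledoux): for `V` `λ`-uniformly convex, `φ ∈ C¹_c` and `δ > 0`, for
all small `ε > 0`, with `ν = e^{-V}dx/Z` and `w = (‖Dφ‖ + δ)²/(8λ)`,
`∫ e^{εφ} dν ≤ (∫ e^{εφ/2 + ε² w} dν)²`. (Apply Prékopa–Leindler with `s = ½` to `e^{-V}`,
`e^{-V+εφ}` and `e^{-V + (ε/2)(φ + (a/2)(‖Dφ‖+δ)²)}`, `a = ε/(2λ)`, using the midpoint convexity of `V`
and the Hopf–Lax bound.) [cite: BrascampLieb1976, Thm 4.1] -/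
theorem integral_exp_tilted_le_sq {V φ : EuclideanSpace ℝ (Fin n) → ℝ} {lam : ℝ} (hlam : 0 < lam)
    (hVc : Continuous V)
    (hV : ∀ x y : EuclideanSpace ℝ (Fin n),
      V x + ⟪gradient V x, y - x⟫ + lam / 2 * ‖y - x‖ ^ 2 ≤ V y)
    (hZ : Integrable fun x => Real.exp (-V x)) (hφ : ContDiff ℝ 1 φ)
    (hφs : HasCompactSupport φ) {δ : ℝ} (hδ : 0 < δ) :
    ∃ ε₀ > 0, ∀ ε, 0 < ε → ε ≤ ε₀ →
      ∫ x, Real.exp (ε * φ x) ∂(volume.tilted fun x => -V x) ≤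
        (∫ x, Real.exp (ε / 2 * φ x + ε ^ 2 * ((‖fderiv ℝ φ x‖ + δ) ^ 2 / (8 * lam)))
          ∂(volume.tilted fun x => -V x)) ^ 2 := by
  obtain ⟨a₀, ha₀, hHL⟩ := hopfLax_le hφ hφs hδ
  obtain ⟨M, hM⟩ := hφ.continuous.bounded_above_of_compact_support hφs
  have hDc : Continuous (fderiv ℝ φ) := hφ.continuous_fderiv one_ne_zero
  obtain ⟨L, hL⟩ := hDc.bounded_above_of_compact_support (hφs.fderiv (𝕜 := ℝ))
  set w : EuclideanSpace ℝ (Fin n) → ℝ := fun x => (‖fderiv ℝ φ x‖ + δ) ^ 2 / (8 * lam) with hw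
  have hwc : Continuous w := ((hDc.norm.add continuous_const).pow 2).div_const _
  have hwb : ∀ x, w x ≤ (L + δ) ^ 2 / (8 * lam) := fun x => by
    have hLx := hL x
    rw [hw]
    exact div_le_div_of_nonneg_right
      (pow_le_pow_left₀ (by positivity) (by linarith) 2) (by positivity)
  have hw0 : ∀ x, 0 ≤ w x := fun x => by rw [hw]; positivity
  have hZpos : 0 < ∫ x, Real.exp (-V x) := integral_exp_pos hZ
  refine ⟨2 * lam * a₀, by positivity, fun ε hε hεle => ?_⟩
  set a := ε / (2 * lam) with ha
  have ha0 : 0 < a := by positivity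
  have haa : a ≤ a₀ := by rw [ha, div_le_iff₀ (by positivity)]; linarith
  -- the Prékopa–Leindler hypothesis
  have hyp : ∀ x y : EuclideanSpace ℝ (Fin n),
      (-V x + (-V y + ε * φ y)) / 2 ≤
        -V ((1 / 2 : ℝ) • x + (1 / 2 : ℝ) • y) +
          (ε / 2 * φ ((1 / 2 : ℝ) • x + (1 / 2 : ℝ) • y) + ε ^ 2 * w ((1 / 2 : ℝ) • x + (1 / 2 : ℝ) • y)) := by
    intro x y
    set m := (1 / 2 : ℝ) • x + (1 / 2 : ℝ) • y with hm
    have h1 := midpoint_le_of_uniformlyConvex hV x y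
    have h2 := hHL a ha0 haa y m
    have hym : ‖y - m‖ ^ 2 = 1 / 4 * ‖x - y‖ ^ 2 := by
      have : y - m = (1 / 2 : ℝ) • (y - x) := by rw [hm]; module
      rw [this, norm_smul, Real.norm_eq_abs, abs_of_pos (by norm_num : (0:ℝ) < 1 / 2), norm_sub_rev]
      ring
    have e1 : ε / 2 * (a / 2 * (‖fderiv ℝ φ m‖ + δ) ^ 2) = ε ^ 2 * w m := by
      rw [hw, ha]; field_simp; ring
    have e2 : ε / 2 * (‖y - m‖ ^ 2 / (2 * a)) = lam / 8 * ‖x - y‖ ^ 2 := by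
      rw [hym, ha]; field_simp; ring
    have key : ε / 2 * φ y - lam / 8 * ‖x - y‖ ^ 2 ≤ ε / 2 * φ m + ε ^ 2 * w m := by
      have := mul_le_mul_of_nonneg_left h2 (by positivity : (0:ℝ) ≤ ε / 2)
      rw [mul_sub, mul_add, e2, e1] at this
      exact this
    rw [← hm] at h1
    linarith
  -- integrability of the three exponentials
  have hφm' : AEStronglyMeasurable (fun x => Real.exp (ε * φ x)) volume :=
    (Real.continuous_exp.comp (continuous_const.mul hφ.continuous)).aestronglyMeasurable
  have hqi : Integrable fun x => Real.exp (-V x + ε * φ x) := by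
    have e : (fun x => Real.exp (-V x + ε * φ x)) =
        fun x => Real.exp (ε * φ x) * Real.exp (-V x) := by
      ext x; rw [Real.exp_add, mul_comm]
    rw [e]
    refine hZ.bdd_mul (c := Real.exp (ε * M)) hφm' (Eventually.of_forall fun x => ?_)
    rw [Real.norm_eq_abs, abs_of_pos (Real.exp_pos _), Real.exp_le_exp]
    have := hM x
    rw [Real.norm_eq_abs] at this
    nlinarith [le_abs_self (φ x)]
  have hrm' : AEStronglyMeasurable (fun x => Real.exp (ε / 2 * φ x + ε ^ 2 * w x)) volume :=
    (Real.continuous_exp.comp ((continuous_const.mul hφ.continuous).add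
      (continuous_const.mul hwc))).aestronglyMeasurable
  have hri : Integrable fun x => Real.exp (-V x + (ε / 2 * φ x + ε ^ 2 * w x)) := by
    have e : (fun x => Real.exp (-V x + (ε / 2 * φ x + ε ^ 2 * w x))) =
        fun x => Real.exp (ε / 2 * φ x + ε ^ 2 * w x) * Real.exp (-V x) := by
      ext x; rw [Real.exp_add, mul_comm]
    rw [e]
    refine hZ.bdd_mul (c := Real.exp (ε / 2 * M + ε ^ 2 * ((L + δ) ^ 2 / (8 * lam)))) hrm'
      (Eventually.of_forall fun x => ?_)
    rw [Real.norm_eq_abs, abs_of_pos (Real.exp_pos _), Real.exp_le_exp]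
    have h1 := hM x
    rw [Real.norm_eq_abs] at h1
    have h2 := hwb x
    nlinarith [le_abs_self (φ x)]
  have PL := integral_exp_mul_integral_exp_le_sq (p := fun x => -V x)
    (q := fun x => -V x + ε * φ x) (r := fun x => -V x + (ε / 2 * φ x + ε ^ 2 * w x))
    hVc.neg (hVc.neg.add (continuous_const.mul hφ.continuous))
    (hVc.neg.add ((continuous_const.mul hφ.continuous).add (continuous_const.mul hwc)))
    hZ hqi hri hyp
  -- pass to the tilted measure
  rw [integral_exp_tilted, integral_exp_tilted]
  simp only [Pi.add_apply]
  rw [div_pow, div_le_div_iff₀ hZpos (pow_pos hZpos 2)]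
  nlinarith [PL, hZpos.le]

/-- **Poincaré inequality for `λ`-uniformly log-concave probability measures, `C¹_c` test
functions**: `Var_ν(φ) ≤ λ⁻¹ ∫ ‖Dφ‖² dν` for `ν = e^{-V}dx/Z`. From `integral_exp_tilted_le_sq` and
`variance_le_of_exp_moment_le` (giving `Var_ν(φ) ≤ λ⁻¹∫(‖Dφ‖+δ)² dν`), letting `δ → 0`.
[cite: BrascampLieb1976, Thm 4.1] -/
theorem variance_tilted_le_of_hasCompactSupport {V φ : EuclideanSpace ℝ (Fin n) → ℝ} {lam : ℝ}
    (hlam : 0 < lam) (hVc : Continuous V)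
    (hV : ∀ x y : EuclideanSpace ℝ (Fin n),
      V x + ⟪gradient V x, y - x⟫ + lam / 2 * ‖y - x‖ ^ 2 ≤ V y)
    (hZ : Integrable fun x => Real.exp (-V x)) (hφ : ContDiff ℝ 1 φ)
    (hφs : HasCompactSupport φ) :
    ∫ x, φ x ^ 2 ∂(volume.tilted fun x => -V x) - (∫ x, φ x ∂(volume.tilted fun x => -V x)) ^ 2 ≤
      lam⁻¹ * ∫ x, ‖fderiv ℝ φ x‖ ^ 2 ∂(volume.tilted fun x => -V x) := by
  set ν : Measure (EuclideanSpace ℝ (Fin n)) := volume.tilted fun x => -V x with hν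
  haveI : IsProbabilityMeasure ν := isProbabilityMeasure_tilted hZ
  obtain ⟨M, hM⟩ := hφ.continuous.bounded_above_of_compact_support hφs
  have hM0 : 0 ≤ M := (norm_nonneg _).trans (hM 0)
  have hDc : Continuous (fderiv ℝ φ) := hφ.continuous_fderiv one_ne_zero
  obtain ⟨L, hL⟩ := hDc.bounded_above_of_compact_support (hφs.fderiv (𝕜 := ℝ))
  have hL0 : 0 ≤ L := (norm_nonneg _).trans (hL 0)
  have hφb : ∀ x, |φ x| ≤ M := fun x => by simpa [Real.norm_eq_abs] using hM x
  have hφm : AEStronglyMeasurable φ ν := hφ.continuous.aestronglyMeasurable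
  have hDn : Continuous fun x => ‖fderiv ℝ φ x‖ := hDc.norm
  have hID : Integrable (fun x => ‖fderiv ℝ φ x‖ ^ 2) ν :=
    integrable_of_abs_le (hDn.pow 2).aestronglyMeasurable (L ^ 2) fun x => by
      rw [abs_of_nonneg (sq_nonneg _)]
      exact pow_le_pow_left₀ (norm_nonneg _) (hL x) 2
  refine le_of_forall_pos_le_add fun η hη => ?_
  -- choose δ with λ⁻¹ (2Lδ + δ²) ≤ η
  set δ : ℝ := min 1 (η * lam / (2 * L + 1)) with hδ_def
  have hδ : 0 < δ := by positivity
  have hδ1 : δ ≤ 1 := min_le_left _ _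
  have hδη : lam⁻¹ * (2 * L * δ + δ ^ 2) ≤ η := by
    have h1 : δ ≤ η * lam / (2 * L + 1) := min_le_right _ _
    rw [le_div_iff₀ (by positivity)] at h1
    have h2 : δ ^ 2 ≤ δ := by nlinarith
    rw [inv_mul_le_iff₀ hlam]
    nlinarith
  obtain ⟨ε₀, hε₀, Hε⟩ := integral_exp_tilted_le_sq hlam hVc hV hZ hφ hφs hδ
  set w : EuclideanSpace ℝ (Fin n) → ℝ := fun x => (‖fderiv ℝ φ x‖ + δ) ^ 2 / (8 * lam) with hw
  have hwc : Continuous w := ((hDn.add continuous_const).pow 2).div_const _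
  have hwb : ∀ x, w x ≤ (L + δ) ^ 2 / (8 * lam) := fun x => by
    have hLx := hL x
    rw [hw]
    exact div_le_div_of_nonneg_right
      (pow_le_pow_left₀ (by positivity) (by linarith) 2) (by positivity)
  have hw0 : ∀ x, 0 ≤ w x := fun x => by rw [hw]; positivity
  have hvar := variance_le_of_exp_moment_le ν hφm hwc.aestronglyMeasurable hM0
    (by positivity : (0:ℝ) ≤ (L + δ) ^ 2 / (8 * lam)) hε₀ hφb hw0 hwb Hε
  -- `8 ∫ w = λ⁻¹ ∫ (‖Dφ‖ + δ)²`
  have hIsq : Integrable (fun x => (‖fderiv ℝ φ x‖ + δ) ^ 2) ν :=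
    integrable_of_abs_le ((hDn.add continuous_const).pow 2).aestronglyMeasurable ((L + δ) ^ 2)
      fun x => by
        rw [abs_of_nonneg (sq_nonneg _)]
        exact pow_le_pow_left₀ (by positivity) (by linarith [hL x]) 2
  have e8 : 8 * ∫ x, w x ∂ν = lam⁻¹ * ∫ x, (‖fderiv ℝ φ x‖ + δ) ^ 2 ∂ν := by
    rw [← integral_const_mul, ← integral_const_mul]
    congr 1; ext x; rw [hw]; field_simp
  -- `∫ (‖Dφ‖ + δ)² ≤ ∫ ‖Dφ‖² + (2Lδ + δ²)`
  have hle : ∫ x, (‖fderiv ℝ φ x‖ + δ) ^ 2 ∂ν ≤ ∫ x, ‖fderiv ℝ φ x‖ ^ 2 ∂ν + (2 * L * δ + δ ^ 2) := by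
    have e : ∫ x, ‖fderiv ℝ φ x‖ ^ 2 ∂ν + (2 * L * δ + δ ^ 2) =
        ∫ x, (‖fderiv ℝ φ x‖ ^ 2 + (2 * L * δ + δ ^ 2)) ∂ν := by
      rw [integral_add hID (integrable_const _)]; simp
    rw [e]
    refine integral_mono hIsq (hID.add (integrable_const _)) fun x => ?_
    have := hL x
    nlinarith [norm_nonneg (fderiv ℝ φ x)]
  calc ∫ x, φ x ^ 2 ∂ν - (∫ x, φ x ∂ν) ^ 2 ≤ 8 * ∫ x, w x ∂ν := hvar
    _ = lam⁻¹ * ∫ x, (‖fderiv ℝ φ x‖ + δ) ^ 2 ∂ν := e8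
    _ ≤ lam⁻¹ * (∫ x, ‖fderiv ℝ φ x‖ ^ 2 ∂ν + (2 * L * δ + δ ^ 2)) :=
        mul_le_mul_of_nonneg_left hle (by positivity)
    _ = lam⁻¹ * ∫ x, ‖fderiv ℝ φ x‖ ^ 2 ∂ν + lam⁻¹ * (2 * L * δ + δ ^ 2) := by ring
    _ ≤ lam⁻¹ * ∫ x, ‖fderiv ℝ φ x‖ ^ 2 ∂ν + η := by linarith

/-! ### From compactly supported to general `C¹` test functions (truncation) -/

/-- Smooth cutoffs `ψ_R(x) = χ(x/R)` from a fixed bump `χ` (`= 1` on the unit ball, supported in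
the ball of radius `2`): `C¹`, compact support, values in `[0,1]`, `ψ_R = 1` on `‖x‖ ≤ R`, and
`‖Dψ_R‖ ≤ K/R`. [folklore] -/
private theorem exists_cutoff (n : ℕ) :
    ∃ (ψ : ℝ → EuclideanSpace ℝ (Fin n) → ℝ) (K : ℝ), 0 ≤ K ∧ ∀ R : ℝ, 1 ≤ R →
      ContDiff ℝ 1 (ψ R) ∧ HasCompactSupport (ψ R) ∧ (∀ x, 0 ≤ ψ R x) ∧ (∀ x, ψ R x ≤ 1) ∧
      (∀ x, ‖x‖ ≤ R → ψ R x = 1) ∧ (∀ x, ‖fderiv ℝ (ψ R) x‖ ≤ K / R) := by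
  let χ : ContDiffBump (0 : EuclideanSpace ℝ (Fin n)) := ⟨1, 2, by norm_num, by norm_num⟩
  have hχ : ContDiff ℝ 1 χ := χ.contDiff
  have hDc : Continuous (fderiv ℝ χ) := hχ.continuous_fderiv one_ne_zero
  obtain ⟨K, hK⟩ := hDc.bounded_above_of_compact_support (χ.hasCompactSupport.fderiv (𝕜 := ℝ))
  have hK0 : 0 ≤ K := (norm_nonneg _).trans (hK 0)
  refine ⟨fun R x => χ (R⁻¹ • x), K, hK0, fun R hR => ?_⟩
  have hR0 : 0 < R := by linarith
  have hnorm : ∀ x : EuclideanSpace ℝ (Fin n), ‖R⁻¹ • x‖ = ‖x‖ / R := fun x => by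
    rw [norm_smul, Real.norm_eq_abs, abs_of_pos (inv_pos.2 hR0), div_eq_inv_mul]
  have hderiv : ∀ x, HasFDerivAt (fun x => χ (R⁻¹ • x))
      ((fderiv ℝ χ (R⁻¹ • x)).comp (R⁻¹ • ContinuousLinearMap.id ℝ _)) x := fun x =>
    (hχ.differentiable one_ne_zero (R⁻¹ • x)).hasFDerivAt.comp x ((hasFDerivAt_id x).const_smul R⁻¹)
  refine ⟨hχ.comp (contDiff_const_smul R⁻¹), ?_, fun x => χ.nonneg, fun x => χ.le_one, ?_, ?_⟩
  · refine HasCompactSupport.intro (isCompact_closedBall (0 : EuclideanSpace ℝ (Fin n)) (2 * R))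
      fun x hx => ?_
    apply χ.zero_of_le_dist
    rw [Metric.mem_closedBall, dist_zero_right, not_le] at hx
    show (2 : ℝ) ≤ dist (R⁻¹ • x) 0
    rw [dist_zero_right, hnorm, le_div_iff₀ hR0]
    linarith
  · intro x hx
    apply χ.one_of_mem_closedBall
    show R⁻¹ • x ∈ Metric.closedBall 0 (1 : ℝ)
    rw [Metric.mem_closedBall, dist_zero_right, hnorm, div_le_one hR0]
    exact hx
  · intro x
    rw [(hderiv x).fderiv]
    calc ‖(fderiv ℝ χ (R⁻¹ • x)).comp (R⁻¹ • ContinuousLinearMap.id ℝ _)‖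
        ≤ ‖fderiv ℝ χ (R⁻¹ • x)‖ * ‖R⁻¹ • ContinuousLinearMap.id ℝ (EuclideanSpace ℝ (Fin n))‖ :=
          ContinuousLinearMap.opNorm_comp_le _ _
      _ ≤ K * R⁻¹ := by
          refine mul_le_mul (hK _) ?_ (norm_nonneg _) hK0
          rw [norm_smul, Real.norm_eq_abs, abs_of_pos (inv_pos.2 hR0)]
          exact mul_le_of_le_one_right (inv_pos.2 hR0).le ContinuousLinearMap.norm_id_le
      _ = K / R := by rw [div_eq_mul_inv]

/-- Algebra for the domination bound: `0 ≤ s ≤ a + b`, `a ≤ p`, `b ≤ K q` give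
`s² ≤ 2p² + 2K²q²`. [folklore] -/
private theorem sq_le_of_le_add {s a b p q K : ℝ} (hs : 0 ≤ s) (hsab : s ≤ a + b) (ha : a ≤ p)
    (hb : b ≤ K * q) : s ^ 2 ≤ 2 * p ^ 2 + 2 * K ^ 2 * q ^ 2 := by
  have ht : s ≤ p + K * q := by linarith
  have h2 : s ^ 2 ≤ (p + K * q) ^ 2 := pow_le_pow_left₀ hs ht 2
  nlinarith [sq_nonneg (p - K * q)]

/-- Domination bound for the derivative of a truncation `χ f` (`0 ≤ χ ≤ 1`, `‖Dχ‖ ≤ K'`):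
`‖D(χf)‖² ≤ 2‖Df‖² + 2K'² f²`. [folklore] -/
private theorem norm_fderiv_cutoff_mul_sq_le {χ f : EuclideanSpace ℝ (Fin n) → ℝ} {K' : ℝ}
    {x : EuclideanSpace ℝ (Fin n)} (hχd : DifferentiableAt ℝ χ x) (hfd : DifferentiableAt ℝ f x)
    (h0 : 0 ≤ χ x) (h1 : χ x ≤ 1) (hD : ‖fderiv ℝ χ x‖ ≤ K') :
    ‖fderiv ℝ (fun y => χ y * f y) x‖ ^ 2 ≤ 2 * ‖fderiv ℝ f x‖ ^ 2 + 2 * K' ^ 2 * f x ^ 2 := by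
  rw [fderiv_fun_mul hχd hfd]
  have hA : ‖χ x • fderiv ℝ f x‖ ≤ ‖fderiv ℝ f x‖ := by
    rw [norm_smul, Real.norm_eq_abs, abs_of_nonneg h0]
    exact mul_le_of_le_one_left (norm_nonneg _) h1
  have hB : ‖f x • fderiv ℝ χ x‖ ≤ K' * |f x| := by
    rw [norm_smul, Real.norm_eq_abs, mul_comm]
    exact mul_le_mul_of_nonneg_right hD (abs_nonneg _)
  have h := sq_le_of_le_add (norm_nonneg _) (norm_add_le _ _) hA hB
  rwa [sq_abs] at h

/-- Pointwise convergence of the derivatives of the truncations: if `c k = 1` eventually and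
`‖D k‖ ≤ K/(k+1)`, then `c k • A + b • D k → A`. [folklore] -/
private theorem tendsto_smul_add_smul {G : Type*} [NormedAddCommGroup G] [NormedSpace ℝ G]
    {c : ℕ → ℝ} {D : ℕ → G} {A : G} {b K : ℝ} (hc : ∀ᶠ k in atTop, c k = 1)
    (hD : ∀ k : ℕ, ‖D k‖ ≤ K / ((k : ℝ) + 1)) :
    Tendsto (fun k => c k • A + b • D k) atTop (𝓝 A) := by
  rw [tendsto_iff_norm_sub_tendsto_zero]
  have hbound : ∀ᶠ k : ℕ in atTop, ‖c k • A + b • D k - A‖ ≤ |b| * K * ((k : ℝ) + 1)⁻¹ := by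
    refine hc.mono fun k hk => ?_
    rw [hk, one_smul, add_sub_cancel_left, norm_smul, Real.norm_eq_abs, mul_assoc]
    refine mul_le_mul_of_nonneg_left ?_ (abs_nonneg _)
    rw [← div_eq_mul_inv]
    exact hD k
  have hlim : Tendsto (fun k : ℕ => |b| * K * ((k : ℝ) + 1)⁻¹) atTop (𝓝 0) := by
    rw [show (0 : ℝ) = |b| * K * 0 by ring]
    exact tendsto_const_nhds.mul (tendsto_inv_atTop_zero.comp
      (tendsto_atTop_add_const_right _ 1 tendsto_natCast_atTop_atTop))
  exact squeeze_zero' (Eventually.of_forall fun k => norm_nonneg _) hbound hlim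

/-- Pointwise facts about the truncations `f_k = ψ_{k+1} f`: convergence of `f_k` and of
`‖Df_k‖²`, and the dominations `|f_k| ≤ |f|`, `‖Df_k‖² ≤ 2‖Df‖² + 2K²f²`. [folklore] -/
private theorem truncation_pointwise {ψ : ℝ → EuclideanSpace ℝ (Fin n) → ℝ} {K : ℝ} (hK0 : 0 ≤ K)
    (hψ : ∀ R : ℝ, 1 ≤ R →
      ContDiff ℝ 1 (ψ R) ∧ HasCompactSupport (ψ R) ∧ (∀ x, 0 ≤ ψ R x) ∧ (∀ x, ψ R x ≤ 1) ∧
      (∀ x, ‖x‖ ≤ R → ψ R x = 1) ∧ (∀ x, ‖fderiv ℝ (ψ R) x‖ ≤ K / R))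
    {f : EuclideanSpace ℝ (Fin n) → ℝ} (hf : ContDiff ℝ 1 f) (x : EuclideanSpace ℝ (Fin n)) :
    Tendsto (fun k : ℕ => ψ ((k : ℝ) + 1) x * f x) atTop (𝓝 (f x)) ∧
    Tendsto (fun k : ℕ => ‖fderiv ℝ (fun y => ψ ((k : ℝ) + 1) y * f y) x‖ ^ 2) atTop
      (𝓝 (‖fderiv ℝ f x‖ ^ 2)) ∧
    (∀ k : ℕ, |ψ ((k : ℝ) + 1) x * f x| ≤ |f x|) ∧
    (∀ k : ℕ, ‖fderiv ℝ (fun y => ψ ((k : ℝ) + 1) y * f y) x‖ ^ 2 ≤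
      2 * ‖fderiv ℝ f x‖ ^ 2 + 2 * K ^ 2 * f x ^ 2) := by
  have hfd : Differentiable ℝ f := hf.differentiable one_ne_zero
  have hk1 : ∀ k : ℕ, (1 : ℝ) ≤ (k : ℝ) + 1 := fun k => by
    have : (0 : ℝ) ≤ k := Nat.cast_nonneg k
    linarith
  have hψd : ∀ k : ℕ, Differentiable ℝ (ψ ((k : ℝ) + 1)) := fun k =>
    (hψ _ (hk1 k)).1.differentiable one_ne_zero
  have hev : ∀ᶠ k : ℕ in atTop, ψ ((k : ℝ) + 1) x = 1 := by
    refine Filter.eventually_atTop.2 ⟨⌈‖x‖⌉₊, fun k hk => (hψ _ (hk1 k)).2.2.2.2.1 x ?_⟩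
    have h1 : ‖x‖ ≤ (⌈‖x‖⌉₊ : ℝ) := Nat.le_ceil _
    have h2 : (⌈‖x‖⌉₊ : ℝ) ≤ k := by exact_mod_cast hk
    linarith
  refine ⟨?_, ?_, fun k => ?_, fun k => ?_⟩
  · exact (tendsto_const_nhds (x := f x)).congr' (hev.mono fun k hk => by
      show f x = ψ ((k : ℝ) + 1) x * f x
      rw [hk, one_mul])
  · have h := tendsto_smul_add_smul (A := fderiv ℝ f x) (b := f x) hev
      (fun k => (hψ _ (hk1 k)).2.2.2.2.2 x)
    have e : (fun k : ℕ => ψ ((k : ℝ) + 1) x • fderiv ℝ f x + f x • fderiv ℝ (ψ ((k : ℝ) + 1)) x) =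
        fun k : ℕ => fderiv ℝ (fun y => ψ ((k : ℝ) + 1) y * f y) x := by
      ext1 k; exact (fderiv_fun_mul (hψd k x) (hfd x)).symm
    rw [e] at h
    exact (h.norm).pow 2
  · rw [abs_mul, abs_of_nonneg ((hψ _ (hk1 k)).2.2.1 x)]
    exact mul_le_of_le_one_left (abs_nonneg _) ((hψ _ (hk1 k)).2.2.2.1 x)
  · exact norm_fderiv_cutoff_mul_sq_le (hψd k x) (hfd x) ((hψ _ (hk1 k)).2.2.1 x)
      ((hψ _ (hk1 k)).2.2.2.1 x) (((hψ _ (hk1 k)).2.2.2.2.2 x).trans (div_le_self hK0 (hk1 k)))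

/-- **Poincaré inequality for `λ`-uniformly log-concave probability measures** `ν = e^{-V}dx/Z`,
for `C¹` test functions `f` with `f, f², ‖Df‖² ∈ L¹(ν)`: `Var_ν(f) ≤ λ⁻¹ ∫ ‖Df‖² dν`.
From the compactly supported case by truncation `f_R = ψ_R f` and dominated convergence.
[cite: BrascampLieb1976, Thm 4.1] -/
theorem variance_tilted_le {V f : EuclideanSpace ℝ (Fin n) → ℝ} {lam : ℝ}
    (hlam : 0 < lam) (hVc : Continuous V)
    (hV : ∀ x y : EuclideanSpace ℝ (Fin n),
      V x + ⟪gradient V x, y - x⟫ + lam / 2 * ‖y - x‖ ^ 2 ≤ V y)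
    (hZ : Integrable fun x => Real.exp (-V x)) (hf : ContDiff ℝ 1 f)
    (h1 : Integrable f (volume.tilted fun x => -V x))
    (h2 : Integrable (fun x => f x ^ 2) (volume.tilted fun x => -V x))
    (h3 : Integrable (fun x => ‖fderiv ℝ f x‖ ^ 2) (volume.tilted fun x => -V x)) :
    ∫ x, f x ^ 2 ∂(volume.tilted fun x => -V x) - (∫ x, f x ∂(volume.tilted fun x => -V x)) ^ 2 ≤
      lam⁻¹ * ∫ x, ‖fderiv ℝ f x‖ ^ 2 ∂(volume.tilted fun x => -V x) := by
  obtain ⟨ψ, K, hK0, hψ⟩ := exists_cutoff n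
  have hk1 : ∀ k : ℕ, (1 : ℝ) ≤ (k : ℝ) + 1 := fun k => by
    have : (0 : ℝ) ≤ k := Nat.cast_nonneg k
    linarith
  have hP := truncation_pointwise hK0 hψ hf
  -- the truncations `F k = ψ_{k+1} · f`
  have hFcd : ∀ k : ℕ, ContDiff ℝ 1 (fun x => ψ ((k : ℝ) + 1) x * f x) := fun k =>
    (hψ _ (hk1 k)).1.mul hf
  have hFcs : ∀ k : ℕ, HasCompactSupport (fun x => ψ ((k : ℝ) + 1) x * f x) := fun k =>
    (hψ _ (hk1 k)).2.1.mul_right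
  have hvar : ∀ k : ℕ, ∫ x, (ψ ((k : ℝ) + 1) x * f x) ^ 2 ∂(volume.tilted fun x => -V x) -
      (∫ x, ψ ((k : ℝ) + 1) x * f x ∂(volume.tilted fun x => -V x)) ^ 2 ≤
      lam⁻¹ * ∫ x, ‖fderiv ℝ (fun y => ψ ((k : ℝ) + 1) y * f y) x‖ ^ 2
        ∂(volume.tilted fun x => -V x) := fun k =>
    variance_tilted_le_of_hasCompactSupport hlam hVc hV hZ (hFcd k) (hFcs k)
  -- dominated convergence
  have lim1 : Tendsto (fun k : ℕ => ∫ x, ψ ((k : ℝ) + 1) x * f x ∂(volume.tilted fun x => -V x))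
      atTop (𝓝 (∫ x, f x ∂(volume.tilted fun x => -V x))) :=
    tendsto_integral_of_dominated_convergence (fun x => |f x|)
      (fun k => (hFcd k).continuous.aestronglyMeasurable) h1.abs
      (fun k => Eventually.of_forall fun x => by
        rw [Real.norm_eq_abs]; exact (hP x).2.2.1 k)
      (Eventually.of_forall fun x => (hP x).1)
  have lim2 : Tendsto (fun k : ℕ => ∫ x, (ψ ((k : ℝ) + 1) x * f x) ^ 2 ∂(volume.tilted fun x => -V x))
      atTop (𝓝 (∫ x, f x ^ 2 ∂(volume.tilted fun x => -V x))) :=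
    tendsto_integral_of_dominated_convergence (fun x => f x ^ 2)
      (fun k => ((hFcd k).continuous.pow 2).aestronglyMeasurable) h2
      (fun k => Eventually.of_forall fun x => by
        rw [Real.norm_eq_abs, abs_of_nonneg (sq_nonneg _), ← sq_abs, ← sq_abs (f x)]
        exact pow_le_pow_left₀ (abs_nonneg _) ((hP x).2.2.1 k) 2)
      (Eventually.of_forall fun x => ((hP x).1).pow 2)
  have hbi : Integrable (fun x => 2 * ‖fderiv ℝ f x‖ ^ 2 + 2 * K ^ 2 * f x ^ 2)
      (volume.tilted fun x => -V x) :=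
    Integrable.add (h3.const_mul 2) (h2.const_mul (2 * K ^ 2))
  have hDm : ∀ k : ℕ, AEStronglyMeasurable
      (fun x => ‖fderiv ℝ (fun y => ψ ((k : ℝ) + 1) y * f y) x‖ ^ 2) (volume.tilted fun x => -V x) :=
    fun k => (((hFcd k).continuous_fderiv one_ne_zero).norm.pow 2).aestronglyMeasurable
  have hDb : ∀ k : ℕ, ∀ᵐ x ∂(volume.tilted fun x => -V x),
      ‖‖fderiv ℝ (fun y => ψ ((k : ℝ) + 1) y * f y) x‖ ^ 2‖ ≤
        2 * ‖fderiv ℝ f x‖ ^ 2 + 2 * K ^ 2 * f x ^ 2 :=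
    fun k => Eventually.of_forall fun x => by
      rw [Real.norm_eq_abs, abs_of_nonneg (sq_nonneg _)]; exact (hP x).2.2.2 k
  have hDl : ∀ᵐ x ∂(volume.tilted fun x => -V x), Tendsto
      (fun k : ℕ => ‖fderiv ℝ (fun y => ψ ((k : ℝ) + 1) y * f y) x‖ ^ 2) atTop
      (𝓝 (‖fderiv ℝ f x‖ ^ 2)) :=
    Eventually.of_forall fun x => (hP x).2.1
  have lim3 : Tendsto (fun k : ℕ => ∫ x, ‖fderiv ℝ (fun y => ψ ((k : ℝ) + 1) y * f y) x‖ ^ 2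
      ∂(volume.tilted fun x => -V x)) atTop
      (𝓝 (∫ x, ‖fderiv ℝ f x‖ ^ 2 ∂(volume.tilted fun x => -V x))) :=
    tendsto_integral_of_dominated_convergence _ hDm hbi hDb hDl
  exact le_of_tendsto_of_tendsto' (lim2.sub (lim1.pow 2)) (lim3.const_mul _) hvar

/-! ### The vendored fact -/

/-- **Brascamp–Lieb variance inequality, uniformly convex case** — discharge of the named fact
`BrascampLieb1976_thm41_uniform` (Brascamp–Lieb 1976, Thm 4.1 with `V'' ≥ λ·1`). Route:
Prékopa–Leindler (BL76 Thm 3.3) ⟹ exponential-moment inequality (Hopf–Lax linearisation, after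
Bobkov–Ledoux) ⟹ Poincaré for `C¹_c` ⟹ general `C¹` by truncation; only the first-order
`λ`-convexity inequality on `V` is used. [cite: BrascampLieb1976, Thm 4.1] -/
theorem BrascampLieb1976_thm41_uniform_holds : BrascampLieb1976_thm41_uniform := by
  intro n V f lam hlam hV2 hf hV hZ h1 h2 h3 m
  have hZpos : 0 < ∫ x, Real.exp (-V x) := integral_exp_pos hZ
  -- `‖∇f‖ = ‖Df‖`
  have hgrad : ∀ x, ‖gradient f x‖ = ‖fderiv ℝ f x‖ := fun x => by
    unfold gradient; simp
  simp_rw [hgrad] at h3 ⊢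
  -- transfer of integrals and integrability to `ν = volume.tilted (-V)`
  have T : ∀ g : EuclideanSpace ℝ (Fin n) → ℝ, ∫ x, g x ∂(volume.tilted fun x => -V x) =
      (∫ x, g x * Real.exp (-V x)) / ∫ x, Real.exp (-V x) := fun g => by
    rw [integral_tilted, ← integral_div]
    congr 1; ext x; rw [smul_eq_mul]; ring
  have I : ∀ g : EuclideanSpace ℝ (Fin n) → ℝ, Integrable (fun x => g x * Real.exp (-V x)) →
      Integrable g (volume.tilted fun x => -V x) := fun g hg => by
    rw [integrable_tilted_iff hZ]
    refine hg.congr (Eventually.of_forall fun x => ?_)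
    simp only [smul_eq_mul]; ring
  have key := variance_tilted_le hlam hV2.continuous hV hZ hf (I _ h1) (I _ h2) (I _ h3)
  rw [T, T, T] at key
  -- expand `∫ (f - m)² e^{-V}`
  have e : ∀ x, (f x - m) ^ 2 * Real.exp (-V x) =
      f x ^ 2 * Real.exp (-V x) - 2 * m * (f x * Real.exp (-V x)) + m ^ 2 * Real.exp (-V x) := by
    intro x; ring
  have hI : Integrable (fun x => f x ^ 2 * Real.exp (-V x) - 2 * m * (f x * Real.exp (-V x))) :=
    h2.sub (h1.const_mul _)
  simp_rw [e]
  rw [integral_add hI (hZ.const_mul _), integral_sub h2 (h1.const_mul _), integral_const_mul,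
    integral_const_mul]
  -- everything in terms of the four numbers `A, B, D, Z`
  set Z : ℝ := ∫ x, Real.exp (-V x) with hZ_def
  set A : ℝ := ∫ x, f x * Real.exp (-V x) with hA_def
  set B : ℝ := ∫ x, f x ^ 2 * Real.exp (-V x) with hB_def
  set D : ℝ := ∫ x, ‖fderiv ℝ f x‖ ^ 2 * Real.exp (-V x) with hD_def
  have hm : m = A / Z := rfl
  rw [hm]
  have hZne : Z ≠ 0 := hZpos.ne'
  have e1 : B - 2 * (A / Z) * A + (A / Z) ^ 2 * Z = Z * (B / Z - (A / Z) ^ 2) := by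
    field_simp
    ring
  have e2 : Z * (lam⁻¹ * (D / Z)) = lam⁻¹ * D := by
    field_simp
  rw [e1, ← e2]
  exact mul_le_mul_of_nonneg_left key hZpos.le

end Euclidean

end Literature.Probability.Moments
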